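/-
Copyright: cell pub-balaban-gaps (YM BLITZ Y1, track G1), planner seat g1-plan-2 (lens structural∕reformulation; unit
`pub-balaban-gaps-g1-plan-2-g3`, landable v1.2); FILED by prover seat g1-p2 (gen 2, unit `pub-balaban-gaps-g1-p2-g2`) per lead
ruling R11 — plan-2's bytes unchanged below this block.  Binder B4 of the T⁴ headline —
joint continuity (C) `FlowStep.BetaContH` — folded into row (D4)'s residue object: kernel bookkeeping BY IMPORT over the an4 chain
and the seats' leaves `Beta.RemainderResidue` ∕ `Gaps.D4Residue` (g1-p2) and `Gaps.D1Residue` (g1-p1); nothing restated.  HONEST FRAMING: nothing of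
Bałaban's series is asserted beyond print; no instance of the residue for Bałaban's split exists in the tree (instance 0∕1); NOT
`BetaPertH`, NOT the continuum limit on ℝ⁴, NOT infinite volume, NOT a mass gap, NOT Clay; 0∕13 main theorems, 0∕9 spine estimates.
-/
import Mathlib
import Literature.MathematicalPhysics.QuantumFieldTheory.Balaban1983to89.Beta.RemainderDecay190HoloChain
import Literature.MathematicalPhysics.QuantumFieldTheory.Balaban1983to89.Beta.BetaContinuity
import Literature.MathematicalPhysics.QuantumFieldTheory.Balaban1983to89.Beta.RemainderResidue
import Literature.MathematicalPhysics.QuantumFieldTheory.Balaban1983to89.Beta.RemainderResidueFamily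
import Literature.MathematicalPhysics.QuantumFieldTheory.Balaban1983to89.Beta.RemainderWitness
import Literature.MathematicalPhysics.QuantumFieldTheory.Balaban1983to89.Beta.OneStepKernelFamily
import Literature.MathematicalPhysics.QuantumFieldTheory.Balaban1983to89.T4ContinuumYM4Torus
import Summits.QuantumFields.BalabanUV.Gaps.D4Residue
import Summits.QuantumFields.BalabanUV.Gaps.D1Residue

/-!
# `Gaps.BetaContFromD4Chain` — binder B4 «joint continuity (C)» of the T⁴ headline is ONE CLAUSE on row (D4)'s residue object
# (cell pub-balaban-gaps, track G1, planner g1-plan-2 skeleton SK-B4 made landable; `HOME/g1/G1-PLAN-D1-CAP.md` row B4)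

HONEST DEPENDENCY (cell pub-balaban, verbatim): continuum YM on T⁴ ⇐ BetaPertH ∧ nine spine estimates (0∕9 proved);
BetaPertH ⇐ (D1) ∧ (D4) ∧ CAP+tail.  HONEST FRAMING: this module proves NO estimate of Bałaban's series.  The headline binder
B4 `hC : FlowStep.BetaContH γc D.βfun` (`T4ContinuumYM4Torus.continuumYM4_torus_of_BetaPertH`; consumed ONLY at
`FlowStepRuns.couplingTrajectory_exists_partialSums`, the IVT in `g₀`) is a HYPOTHESIS ON DATA like (D4); what is shown here is
that it is NOT AN INDEPENDENT GAP: given row (D4)'s residue object of record — ONE inhabitant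
`R : Beta.RemainderDecay190HoloChain.ChainTFac190H d M μ ν S γ c ℓ α₂ q` with its numeric side conditions (g1-p2's
`Beta.RemainderResidue.AtSlope`) — (C) costs exactly ONE further clause of printed TYPE,
  (C-pt) `CPt R : ∀ k x, ContinuousOn (fun p ↦ limKernel (R.A1 k p) x) (Box γ k)`
(termwise continuity IN THE HISTORY `p = (g_0,…,g_k)` of the infinite-volume remainder kernel, per scale, per site; [I] p. 264,
the sentence after (1.22): the coefficients are «analytic functions of g_j … with bounded derivatives»), because `β⁰_{k+1}` is
history-free (`B12Beta.OneLoopSplit`) and the chain's leaves give the (5.10) decay of the kernel with constants uniform in the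
history, so the M-test sums (C-pt) (`Beta.BetaContinuity.betaContH_of_split_kernel`).  Every proof is a few lines over theorems
already in the tree, imported, not restated.  Statement-layer record for `BALABAN-GAPS.md` §A row B4 and `g1/ROUTES-PLAN-2.md` §2 S5.

CITATION HEADER (lean-in-tree rule).  [I] = [Balaban1987RG1] Commun. Math. Phys. 109: Thm 2 p. 259 (first sentence), (1.20)–(1.22)
p. 264, (4.4) p. 281, (5.10) p. 293; [II] = [Balaban1988RG2Cluster] Commun. Math. Phys. 116: Lemma 3 (2.38) p. 20.  Quotations as
certified in the imported modules; `[cite: …]` tags are CONTEXT ONLY; the manuscripts under audit are not cited for deferred steps.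

## What is here

* §1 `CPt R` (the clause) and `betaContH_of_chainTFac190H` ∕ `betaContH_of_chainTFac190`: B4 ⇐ ONE (D4) chain instance + its four
  side conditions + (C-pt), any dimension `d ≥ 1` (holomorphic and analytic currency).
* §2 `AtSlopeCont Sβ γ₀ s` := g1-p2's `AtSlope Sβ γ₀ s` with the clause (C-pt) carried by the SAME inhabitant (d = 4);
  `atSlope_of_atSlopeCont`, `betaContH_of_atSlopeCont`, `remainderConst_of_atSlopeCont`, and the two constructors.
* §3 THE WALL END WITH B4 ABSORBED: `endpointExistence_of_D1Drift_atSlopeCont` — forward generation, the pinned split (`hβ`), the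
  drift (D1) `D1Drift`, and `AtSlopeCont Sβ γ₀ (stepBal N Lc)` ⟹ `EndpointExistence` with (UP) AND (C) DERIVED
  (`Gaps.D4Residue.endpointExistence_of_D1Drift_atSlope` ∘ §2); `endpointExistence_of_residue_atSlopeCont` — the same with (D1)
  replaced by g1-p1's named residue `Gaps.D1Residue.Residue` (`Gaps.D1Residue.endpointExistence_of_residue_atSlope` ∘ §2): THE
  β-SIDE OF THE HEADLINE IN TWO NAMED PREDICATES, `Residue` (row (D1)) ∧ `AtSlopeCont` (rows (D4) ∧ B4) — no separate B4 owner; and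
  the T⁴ headline in that currency, non-vacuous form (`continuumYM4Torus_of_residue_atSlopeCont` =
  `T4ContinuumYM4Torus.continuumYM4_torus_of_endpointExistence_nonvacuous` with `hEnd` so supplied; (B) and the spine slot stay
  binders).  Plus the generic-`d` drift and telescoped ENDs over one chain (`…_cpt`).
* §4 (POINTER ONLY, no decl — a re-export would duplicate a landed theorem): independently B4 ⇐ spine node U2's Lipschitz
  input, `T4BetaStationary.betaContH_of_histLipschitz : HistLipschitz Λ γ β → BetaContH γ β` (tree, by name; the converse fails).
* §5 NON-VACUITY: `cpt_ofAnalytic_zeroChain190` (the zero-activity witness of `Beta.RemainderWitness` satisfies (C-pt): its kernel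
  is history-free), `atSlopeCont_splitZero`, `residue_side_inhabited_cont` — the sharpened residue is INHABITED as typed at the
  witness records `c₀ 4`, `q₀`, split `splitZero`; for BAŁABAN's construction the count is 0∕1.

## What is NOT here

No object of Bałaban's is constructed; (C-pt) for Bałaban's kernels is NOT proved (its three tree dischargers
`LocalizedVolumeRate.betaContH_of_chain_localized`, `BetaContinuityVolume.betaContH_of_chain_volumeRate`,
`HistoryContinuity.betaContH_of_chain_towers` take volume-side inputs no printed source states as a theorem); no leaf of row (D4)
is discharged; (D1) is untouched.  No `sorry`, no axiom beyond the standard trio.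
-/

namespace Summit.QuantumFields.BalabanUV.Gaps.BetaContFromD4Chain

open Literature.MathematicalPhysics.QuantumFieldTheory.Balaban1983to89
open Literature.MathematicalPhysics.QuantumFieldTheory.Balaban1983to89.FlowStep
open Literature.MathematicalPhysics.QuantumFieldTheory.Balaban1983to89.DagBinding
open Literature.MathematicalPhysics.QuantumFieldTheory.Balaban1983to89.FlowStepRuns
open Literature.MathematicalPhysics.QuantumFieldTheory.Balaban1983to89.T4Continuum
open Literature.MathematicalPhysics.QuantumFieldTheory.Balaban1983to89.T4ContinuumYM4Torus
open Literature.MathematicalPhysics.QuantumFieldTheory.Balaban1983to89.B13ScaleTransfer (Pt)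
open Literature.MathematicalPhysics.QuantumFieldTheory.Balaban1983to89.Beta.Drift (OneLoopDrift)
open Literature.MathematicalPhysics.QuantumFieldTheory.Balaban1983to89.Beta.RemainderChain (RemainderConst remActivity)
open Literature.MathematicalPhysics.QuantumFieldTheory.Balaban1983to89.Beta.RemainderChainLattice
open Literature.MathematicalPhysics.QuantumFieldTheory.Balaban1983to89.Beta.RemainderLimitTorus (LDom limKernel)
open Literature.MathematicalPhysics.QuantumFieldTheory.Balaban1983to89.Beta.RemainderLimitTorusHolo
open Literature.MathematicalPhysics.QuantumFieldTheory.Balaban1983to89.Beta.RemainderDecay190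
open Literature.MathematicalPhysics.QuantumFieldTheory.Balaban1983to89.Beta.RemainderDecay190HoloChain
open Literature.MathematicalPhysics.QuantumFieldTheory.Balaban1983to89.Beta.BetaContinuity
open Literature.MathematicalPhysics.QuantumFieldTheory.Balaban1983to89.Beta.DriftRemainder
open Literature.MathematicalPhysics.QuantumFieldTheory.Balaban1983to89.Beta.RemainderResidue
  (AtSlope remainderConst_of_atSlope)
open Literature.MathematicalPhysics.QuantumFieldTheory.Balaban1983to89.Beta.RemainderWitness
  (c₀ q₀ splitZero zeroChain190 c₀_condsL c₀_R22gen c₀_activity_pos q₀_valid_c₀)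
open Literature.MathematicalPhysics.QuantumFieldTheory.Balaban1983to89.Beta.OneStepKernelFamily (D1Drift TbalOf)
open Literature.MathematicalPhysics.QuantumFieldTheory.Balaban1983to89.Beta.OneStepResolventKernel (JetData)
open Metric Filter Topology

variable {d M : ℕ} [NeZero M] {μ ν : Fin d} {β : HBeta} {S : B12Beta.OneLoopSplit β} {γ : ℝ} {c : B13.Consts}
  {ℓ α₂ : ℝ} {q : Consts190}

/-! ## §1. (C) from ONE row-(D4) chain instance + the clause (C-pt), any `d ≥ 1` -/

/-- **(C-pt) — the ONE clause B4 adds to row (D4)**: termwise continuity in the history `p = (g_0,…,g_k) ∈ ]0,γ]^{k+1}` of the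
infinite-volume remainder kernel `x ↦ limKernel (R.A1 k p) x = Σ'_Y A¹_{k+1}(p; Y, x)` of the chain `R`, per scale `k` and per site
`x`.  HYPOTHESIS SHAPE on the chain's data (printed TYPE: [I] p. 264, after (1.22)), never asserted; no instance for Bałaban's kernels.
[cite: Balaban1987RG1, (1.21)-(1.22) p.264] -/
def CPt (R : ChainTFac190H d M μ ν S γ c ℓ α₂ q) : Prop :=
  ∀ k (x : Pt d), ContinuousOn (fun p : Fin (k + 1) → ℝ => limKernel (R.A1 k p) x) (Box γ k)

/-- **B4 ⇐ (D4)-object + (C-pt)** (holomorphic currency): ONE `ChainTFac190H` instance with the side conditions `CondsL`, the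
closing relation `R22gen`, the (190) validity and the printed signs, plus (C-pt), gives `BetaContH γ β` — composition of
`BetaContinuity.betaContH_of_split_kernel` (M-test) with the leaves' (5.10) decay `PolLeavesTLocH.decay510` (constants
`A_rem · K_Π,L`, `δ_L`: k-free, history-free); the `ChainTFac190H` ∕ `limKernel` currency transfer of the existing reduction
`Beta.BetaContinuity.betaContH_of_chain` (ℤ^d `RemainderChain.Chain` currency), not a new one.
[cite: Balaban1987RG1, (1.22) p.264 and (5.10) p.293] -/
theorem betaContH_of_chainTFac190H (R : ChainTFac190H d M μ ν S γ c ℓ α₂ q) (hC : CondsL d c ℓ) (h22 : c.R22gen ℓ)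
    (hq : q.Valid c.δ₀) (hs : SignsL c α₂ q.B₃) (hd : 0 < d) (hcont : CPt R) : BetaContH γ β :=
  betaContH_of_split_kernel μ ν S (fun k p => fun _ _ => limKernel (R.A1 k p)) R.beta1_eq (fun k x => hcont k x)
    fun k => ⟨remActivity c * polConstL d M c α₂ q.B₃, deltaL d M c, deltaL_pos hC hs.δ₀_pos hd (Nat.pos_of_neZero M),
      fun v hv => (((R.toChainTFacH hq).toChainTLocH hs.α₂_pos).leaves k v (histBox_of_mem_box hv)).decay510 hC h22 hs hd⟩

/-- The same over the ANALYTIC-currency socket `RemainderDecay190.ChainTFac190` (`ChainTFac190H.ofAnalytic`). [folklore] -/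
theorem betaContH_of_chainTFac190 (R : ChainTFac190 d M μ ν S γ c ℓ α₂ q) (hC : CondsL d c ℓ) (h22 : c.R22gen ℓ)
    (hq : q.Valid c.δ₀) (hs : SignsL c α₂ q.B₃) (hd : 0 < d) (hcont : CPt (ChainTFac190H.ofAnalytic R)) : BetaContH γ β :=
  betaContH_of_chainTFac190H (ChainTFac190H.ofAnalytic R) hC h22 hq hs hd hcont

/-! ## §2. `AtSlopeCont`: g1-p2's residue `AtSlope` with the clause carried by the same inhabitant (d = 4) -/

/-- **`AtSlopeCont Sβ γ₀ s` — the residue of rows (D4) ∧ B4 TOGETHER at slope `s` on the boxes `]0,γ₀]^{k+1}`** (d = 4): the data of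
`Beta.RemainderResidue.AtSlope Sβ γ₀ s` (cube side `M`, channel `(μ, ν)`, [II]-record `c`, transfer factor `ℓ`, (4.4)-radius `α₂`,
(190)-record `q`, an INHABITANT `R` of `ChainTFac190H 4 M μ ν Sβ γ₀ c ℓ α₂ q`, `CondsL`, `R22gen`, `Consts190.Valid`, `SignsL`,
`ε₁ · K_rem,L ≤ s`) with the ONE extra clause `CPt R` on THAT inhabitant.  A PREDICATE (hypothesis shape), never asserted; for
Bałaban's split no inhabitant exists in the tree.
[cite: Balaban1988RG2Cluster, Lemma 3 (2.38) p.20; Balaban1987RG1, (1.20)-(1.22) p.264, (4.4) p.281] -/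
def AtSlopeCont {β : HBeta} (Sβ : B12Beta.OneLoopSplit β) (γ₀ s : ℝ) : Prop :=
  ∃ (M : ℕ) (_ : NeZero M) (μ ν : Fin 4) (c : B13.Consts) (ℓ α₂ : ℝ) (q : Consts190)
    (R : ChainTFac190H 4 M μ ν Sβ γ₀ c ℓ α₂ q), CPt R ∧ CondsL 4 c ℓ ∧ c.R22gen ℓ ∧ q.Valid c.δ₀ ∧ SignsL c α₂ q.B₃ ∧
      c.ε₁ * remCoeffL 4 M c α₂ q.B₃ ≤ s

/-- `AtSlopeCont` ⟹ g1-p2's `AtSlope` (forget the clause). [folklore] -/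
theorem atSlope_of_atSlopeCont {β : HBeta} {Sβ : B12Beta.OneLoopSplit β} {γ₀ s : ℝ} (h : AtSlopeCont Sβ γ₀ s) :
    AtSlope Sβ γ₀ s := by
  obtain ⟨M, inst, μ, ν, c, ℓ, α₂, q, R, -, hC, h22, hq, hs, hε⟩ := h
  exact ⟨M, inst, μ, ν, c, ℓ, α₂, q, ⟨R⟩, hC, h22, hq, hs, hε⟩

/-- **`AtSlopeCont` ⟹ B4 on the same box**: `BetaContH γ₀ β` (§1 at d = 4). [cite: Balaban1987RG1, (1.22) p.264 and (5.10) p.293] -/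
theorem betaContH_of_atSlopeCont {β : HBeta} {Sβ : B12Beta.OneLoopSplit β} {γ₀ s : ℝ} (h : AtSlopeCont Sβ γ₀ s) :
    BetaContH γ₀ β := by
  obtain ⟨M, inst, μ, ν, c, ℓ, α₂, q, R, hcpt, hC, h22, hq, hs, -⟩ := h
  exact betaContH_of_chainTFac190H R hC h22 hq hs (by norm_num) hcpt

/-- `AtSlopeCont` ⟹ the constant form `RemainderConst Sβ γ₀ s` (g1-p2's `remainderConst_of_atSlope`).
[cite: Balaban1988RG2Cluster, (2.38) p.20; Balaban1987RG1, (1.22) p.264] -/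
theorem remainderConst_of_atSlopeCont {β : HBeta} {Sβ : B12Beta.OneLoopSplit β} {γ₀ s : ℝ} (h : AtSlopeCont Sβ γ₀ s) :
    RemainderConst Sβ γ₀ s :=
  remainderConst_of_atSlope (atSlope_of_atSlopeCont h)

/-- Constructor, holomorphic currency: one chain + side conditions + smallness + (C-pt). [folklore] -/
theorem atSlopeCont_of_chainTFac190H {β : HBeta} {Sβ : B12Beta.OneLoopSplit β} {γ₀ s : ℝ} {M : ℕ} [NeZero M]
    {μ ν : Fin 4} {c : B13.Consts} {ℓ α₂ : ℝ} {q : Consts190} (R : ChainTFac190H 4 M μ ν Sβ γ₀ c ℓ α₂ q)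
    (hC : CondsL 4 c ℓ) (h22 : c.R22gen ℓ) (hq : q.Valid c.δ₀) (hs : SignsL c α₂ q.B₃)
    (hsmall : c.ε₁ * remCoeffL 4 M c α₂ q.B₃ ≤ s) (hcont : CPt R) : AtSlopeCont Sβ γ₀ s :=
  ⟨M, inferInstance, μ, ν, c, ℓ, α₂, q, R, hcont, hC, h22, hq, hs, hsmall⟩

/-- Constructor, analytic currency (`ChainTFac190H.ofAnalytic`). [folklore] -/
theorem atSlopeCont_of_chainTFac190 {β : HBeta} {Sβ : B12Beta.OneLoopSplit β} {γ₀ s : ℝ} {M : ℕ} [NeZero M]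
    {μ ν : Fin 4} {c : B13.Consts} {ℓ α₂ : ℝ} {q : Consts190} (R : ChainTFac190 4 M μ ν Sβ γ₀ c ℓ α₂ q)
    (hC : CondsL 4 c ℓ) (h22 : c.R22gen ℓ) (hq : q.Valid c.δ₀) (hs : SignsL c α₂ q.B₃)
    (hsmall : c.ε₁ * remCoeffL 4 M c α₂ q.B₃ ≤ s) (hcont : CPt (ChainTFac190H.ofAnalytic R)) : AtSlopeCont Sβ γ₀ s :=
  atSlopeCont_of_chainTFac190H (ChainTFac190H.ofAnalytic R) hC h22 hq hs hsmall hcont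

/-! ## §3. The wall END with B4 absorbed into the (D4) residue: (D1) + `AtSlopeCont` ⟹ endpoint existence -/

section Wall

variable {Lc : ℕ} [NeZero Lc]

/-- **THE WALL END WITH B4 ABSORBED** (d = 4): forward generation, the split with its one-loop part pinned to the typed step kernels
(`hβ`, row (D1)'s identification), the drift (D1) `D1Drift Lc Js N μ ν`, and `AtSlopeCont Sβ γ₀ (stepBal N Lc)` ⟹ endpoint
existence ([I] Thm 2, first sentence) — (UP) AND (C) DERIVED, so the β-side residue list is (D1) ∧ ((D4)-object + (C-pt)): no
separate B4 binder.  `Gaps.D4Residue.endpointExistence_of_D1Drift_atSlope` ∘ §2.  Discharges nothing: every binder a hypothesis.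
[cite: Balaban1987RG1, Thm 2 p.259 (first sentence); Balaban1988RG2Cluster, (2.38) p.20] -/
theorem endpointExistence_of_D1Drift_atSlopeCont {β : HBeta} {Cn : B12.Construction} (hgen : ForwardGenerated Cn β)
    (Sβ : B12Beta.OneLoopSplit β) (Js : ℕ → JetData 3 Lc) {N : ℝ} {μ ν : Fin 4}
    (hβ : ∀ j, Sβ.β0 j = B12Beta.secondMoment (TbalOf Lc Js j) μ ν) (hD : D1Drift Lc Js N μ ν) {γ₀ : ℝ} (hγ₀ : 0 < γ₀)
    (hres : AtSlopeCont Sβ γ₀ (B12Normalization.stepBal N Lc)) : EndpointExistence Cn :=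
  D4Residue.endpointExistence_of_D1Drift_atSlope hgen Sβ Js hβ hD hγ₀ (atSlope_of_atSlopeCont hres)
    (betaContH_of_atSlopeCont hres)

/-- **THE β-SIDE OF THE HEADLINE IN TWO NAMED PREDICATES** (d = 4): forward generation, the pinned split (`hβ`), g1-p1's residue of
row (D1) `Gaps.D1Residue.Residue Lc Js N μ ν` (some composite jet family telescopes onto the step family up to `O(1)` AND obeys the
one-shot law) and `AtSlopeCont Sβ γ₀ (stepBal N Lc)` (rows (D4) ∧ B4) ⟹ endpoint existence — the drift (D1), the constant (D4), (UP)
and (C) ALL DERIVED (`Gaps.D1Residue.endpointExistence_of_residue_atSlope` ∘ §2).  Every binder a hypothesis; instance 0∕1 for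
Bałaban's construction on both predicates. [cite: Balaban1987RG1, Thm 2 p.259 (first sentence); Balaban1988RG2Cluster, (2.38) p.20] -/
theorem endpointExistence_of_residue_atSlopeCont {β : HBeta} {Cn : B12.Construction} (hgen : ForwardGenerated Cn β)
    (Sβ : B12Beta.OneLoopSplit β) (Js : ℕ → JetData 3 Lc) {N : ℝ} {μ ν : Fin 4}
    (hβ : ∀ j, Sβ.β0 j = B12Beta.secondMoment (TbalOf Lc Js j) μ ν) (h : D1Residue.Residue Lc Js N μ ν) {γ₀ : ℝ}
    (hγ₀ : 0 < γ₀) (hres : AtSlopeCont Sβ γ₀ (B12Normalization.stepBal N Lc)) : EndpointExistence Cn :=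
  D1Residue.endpointExistence_of_residue_atSlope hgen Sβ Js hβ h hγ₀ (atSlope_of_atSlopeCont hres)
    (betaContH_of_atSlopeCont hres)

end Wall

section DatumSU

variable {Lc : ℕ} [NeZero Lc] {F : T4Family} {N : ℕ} [NeZero N]

/-- **THE T⁴ HEADLINE WITH ITS β-SIDE IN THE TWO NAMED PREDICATES, NON-VACUOUS FORM** (∀-form ∧ ∃-form): a printed-averaged datum `D`
on `SU(N)`, (B), a one-loop split `Sβ` of the datum's β-family `D.βfun` pinned to the typed step kernels (`hβ`, colour number `N`),
row (D1)'s residue `Gaps.D1Residue.Residue Lc Js N μ ν`, rows (D4) ∧ B4's residue `AtSlopeCont Sβ γ₀ (stepBal N Lc)`, and the spine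
slot under endpoint existence ⟹ `ContinuumYM4Torus D ∧ ContinuumYM4TorusE D`
(`T4ContinuumYM4Torus.continuumYM4_torus_of_endpointExistence_nonvacuous` with `hEnd` from §3; forward generation is the datum's
field `D.fwd`).  Finite four-torus, averaged loops; every binder a hypothesis; NOT ℝ⁴, NOT a mass gap. [cite: Balaban1987RG1, Thm 2 p.259] -/
theorem continuumYM4Torus_of_residue_atSlopeCont (D : FiniteEpsData F (Matrix.specialUnitaryGroup (Fin N) ℂ))
    (hD : D.IsPrintedAveraged) (hB : B16.EndStatementBPrinted D.C) (Sβ : B12Beta.OneLoopSplit D.βfun) (Js : ℕ → JetData 3 Lc)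
    {μ ν : Fin 4} (hβ : ∀ j, Sβ.β0 j = B12Beta.secondMoment (TbalOf Lc Js j) μ ν) (h : D1Residue.Residue Lc Js (N : ℝ) μ ν)
    {γ₀ : ℝ} (hγ₀ : 0 < γ₀) (hres : AtSlopeCont Sβ γ₀ (B12Normalization.stepBal (N : ℝ) Lc))
    (hNE : T4ApexHybrid.HybridNE7Under D (EndpointExistence D.C.toB12)) : ContinuumYM4Torus D ∧ ContinuumYM4TorusE D :=
  continuumYM4_torus_of_endpointExistence_nonvacuous D hD hB
    (endpointExistence_of_residue_atSlopeCont D.fwd Sβ Js hβ h hγ₀ hres) hNE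

end DatumSU

/-- **Generic `d`: ENDPOINT EXISTENCE ⇐ drift + ONE chain + (C-pt)**, (UP) and (C) DERIVED
(`DriftRemainder.endpointExistence_of_drift_remainderConst_cont` ∘ `ChainTFac190H.abs_beta1_le` ∘ §1).
[cite: Balaban1987RG1, Thm 2 p.259 (first sentence); Balaban1988RG2Cluster, (2.38) p.20] -/
theorem endpointExistence_of_drift_chainTFac190H_cpt {C : B12.Construction} (hgen : ForwardGenerated C β)
    (R : ChainTFac190H d M μ ν S γ c ℓ α₂ q) (hC : CondsL d c ℓ) (h22 : c.R22gen ℓ) (hq : q.Valid c.δ₀)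
    (hs : SignsL c α₂ q.B₃) (hd : 0 < d) (hγ : 0 < γ) {b A : ℝ} (hdrift : OneLoopDrift b A S.β0)
    (hε₁ : c.ε₁ * remCoeffL d M c α₂ q.B₃ ≤ b) (hcont : CPt R) : EndpointExistence C :=
  endpointExistence_of_drift_remainderConst_cont hgen S hγ hdrift (R.abs_beta1_le hC h22 hq hs hd) hε₁
    (betaContH_of_chainTFac190H R hC h22 hq hs hd hcont)

/-- **Generic `d`, telescoped (D1) currency** (`Σ_{j<k} β⁰_j = B(L^k)`, `|B n − b log n| ≤ A`), (C) DERIVED from (C-pt), (UP) kept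
as the printed binder (`RemainderDecay190HoloChain.endpointExistence_of_telescope_chainTFac190H`).
[cite: Balaban1987RG1, Thm 2 p.259 (first sentence)] -/
theorem endpointExistence_of_telescope_chainTFac190H_cpt {C : B12.Construction} (hgen : ForwardGenerated C β)
    {b A β' : ℝ} {B : ℕ → ℝ} {L : ℕ} (R : ChainTFac190H d M μ ν S γ c ℓ α₂ q) (hC : CondsL d c ℓ)
    (h22 : c.R22gen ℓ) (hq : q.Valid c.δ₀) (hs : SignsL c α₂ q.B₃) (hd : 0 < d) (hγ : 0 < γ) (hL : 2 ≤ L)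
    (hA : 0 ≤ A) (hTel : ∀ k : ℕ, ∑ j ∈ Finset.range k, S.β0 j = B (L ^ k))
    (hB : ∀ n : ℕ, 2 ≤ n → |B n - b * Real.log n| ≤ A) (hε₁ : c.ε₁ * remCoeffL d M c α₂ q.B₃ ≤ b * Real.log L)
    (hβ' : 0 ≤ β') (hcont : CPt R) (hup : BetaUpperH β' γ β) : EndpointExistence C :=
  endpointExistence_of_telescope_chainTFac190H hgen R hC h22 hq hs hd hγ hL hA hTel hB hε₁ hβ'
    (betaContH_of_chainTFac190H R hC h22 hq hs hd hcont) hup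

/-! ## §4. Independently: B4 ⇐ spine node U2's Lipschitz input — POINTER ONLY: `T4BetaStationary.betaContH_of_histLipschitz`
(cell GAPS row G-t4-U2-2; if the coupling-matching node is discharged in Lipschitz currency on the box `γ`, B4 on that box is a
corollary; no re-export here, the tree theorem is cited by name). -/

/-! ## §5. Non-vacuity: the sharpened residue is inhabited at the zero-activity witness of `Beta.RemainderWitness` -/

/-- **The zero-activity witness satisfies (C-pt)** (any `d`, `M`, channel, box, records): its remainder kernel `A1 = 0` is
history-free, so each `p ↦ limKernel (A1 k p) x` is constant on the box. [folklore] -/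
theorem cpt_ofAnalytic_zeroChain190 (d M : ℕ) [NeZero M] (μ ν : Fin d) (γ : ℝ) (c : B13.Consts) (ℓ α₂ : ℝ)
    (hA : 0 ≤ c.C3act * c.ε₁) : CPt (ChainTFac190H.ofAnalytic (zeroChain190 d M μ ν γ c ℓ α₂ hA)) := fun k x => by
  show ContinuousOn (fun _ : Fin (k + 1) → ℝ => limKernel (fun (_ : LDom d) (_ : Pt d) => (0 : ℝ)) x) (Box γ k)
  exact continuousOn_const

/-- **`AtSlopeCont` is inhabited** for the trivial split `splitZero` at the witness records `c₀ 4`, `ℓ = 2`, `α₂ = 1`, `q₀`, any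
`M ≥ 1`, any box, at the slope `s := ε₁(c₀ 4) · K_rem,L(4, M, c₀ 4, 1, B₃(q₀))` — the predicate is satisfiable as typed (the count
for Bałaban's split stays 0∕1); same witness as `Gaps.D4Residue.atSlope_splitZero`. [folklore] -/
theorem atSlopeCont_splitZero (M : ℕ) [NeZero M] (γ₀ : ℝ) :
    AtSlopeCont splitZero γ₀ ((c₀ 4).ε₁ * remCoeffL 4 M (c₀ 4) 1 q₀.B₃) :=
  atSlopeCont_of_chainTFac190 (zeroChain190 4 M 0 1 γ₀ (c₀ 4) 2 1 (c₀_activity_pos 4).le) (c₀_condsL 4) (c₀_R22gen 4)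
    (q₀_valid_c₀ 4) ((q₀_valid_c₀ 4).signsL (c₀_activity_pos 4).le one_pos D4Residue.c₀_four_δ₀_pos) le_rfl
    (cpt_ofAnalytic_zeroChain190 4 M 0 1 γ₀ (c₀ 4) 2 1 (c₀_activity_pos 4).le)

/-- **The wall END §3 is NOT VACUOUS on the residue side**: at the witness world the sharpened residue holds, hence (by §2) g1-p2's
`AtSlope`, its `RemainderConst` consequence AND B4 on the box — all BY NAME from `atSlopeCont_splitZero`. [folklore] -/
theorem residue_side_inhabited_cont (M : ℕ) [NeZero M] (γ₀ : ℝ) :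
    AtSlopeCont splitZero γ₀ ((c₀ 4).ε₁ * remCoeffL 4 M (c₀ 4) 1 q₀.B₃) ∧
      AtSlope splitZero γ₀ ((c₀ 4).ε₁ * remCoeffL 4 M (c₀ 4) 1 q₀.B₃) ∧
      RemainderConst splitZero γ₀ ((c₀ 4).ε₁ * remCoeffL 4 M (c₀ 4) 1 q₀.B₃) ∧
      BetaContH γ₀ (fun _ _ => (1 : ℝ)) :=
  ⟨atSlopeCont_splitZero M γ₀, atSlope_of_atSlopeCont (atSlopeCont_splitZero M γ₀),
    remainderConst_of_atSlopeCont (atSlopeCont_splitZero M γ₀), betaContH_of_atSlopeCont (atSlopeCont_splitZero M γ₀)⟩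


/-! ## §6. (v1.2, plan-2 T-2) The FAMILY-level residue of rows (D4) ∧ B4 together: `ObjectsFamilyCont` -/

section Family

open Literature.MathematicalPhysics.QuantumFieldTheory.Balaban1983to89.Beta.RemainderResidue (constsAt condsL_constsAt
  remCoeffL_constsAt)
open Literature.MathematicalPhysics.QuantumFieldTheory.Balaban1983to89.Beta.RemainderResidueFamily (ObjectsFamily)

/-- The sign record for every smaller non-negative activity (re-proved locally; `constsAt c e` changes `ε₁` only). [folklore] -/
private theorem signsL_constsAt' {c' : B13.Consts} {α₂' B₃ : ℝ} (hs : SignsL c' α₂' B₃) (hC3 : 0 ≤ c'.C3act) {e : ℝ}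
    (he : 0 ≤ e) : SignsL (constsAt c' e) α₂' B₃ :=
  ⟨show 0 ≤ c'.C3act * e from mul_nonneg hC3 he, hs.α₂_pos, hs.B₃_nonneg, hs.δ₀_pos⟩

/-- `0 ≤ C₃·ε₁` with `ε₁ > 0` gives `0 ≤ C₃` (re-proved locally). [folklore] -/
private theorem C3act_nonneg_of_signsL' {c' : B13.Consts} {α₂' B₃ : ℝ} (hs : SignsL c' α₂' B₃) (hε : 0 < c'.ε₁) :
    0 ≤ c'.C3act := by
  by_contra h
  have : c'.C3act * c'.ε₁ < 0 := mul_neg_of_neg_of_pos (not_le.mp h) hε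
  linarith [hs.A]

/-- **`ObjectsFamilyCont βf Sf` — the pure object residue of Bałaban's SCHEME (g1-p2's `RemainderResidueFamily.ObjectsFamily`:
one [II]-record `c` and (190)-record `q` meeting N1–N2, and for every activity `e ∈ ]0, c.ε₁]` a box `γ₀(e) > 0` with an
inhabitant of `ChainTFac190H 4 M μ ν (Sf e) γ₀ (constsAt c e) ℓ α₂ q`) with the ONE clause (C-pt) `CPt R` carried by EACH
member's inhabitant** — the family-level residue of rows (D4) ∧ B4 TOGETHER (d = 4).  A PREDICATE (hypothesis shape), never
asserted; for Bałaban's family no inhabitant exists in the tree (0∕1).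
[cite: Balaban1988RG2Cluster, Lemma 3 (2.38) p.20 and p.21; Balaban1987RG1, (1.20)-(1.22) p.264, Thm 3 p.264] -/
def ObjectsFamilyCont (βf : ℝ → HBeta) (Sf : (e : ℝ) → B12Beta.OneLoopSplit (βf e)) : Prop :=
  ∃ (M : ℕ) (_ : NeZero M) (μ ν : Fin 4) (c : B13.Consts) (ℓ α₂ : ℝ) (q : Consts190),
    0 < c.ε₁ ∧ CondsL 4 c ℓ ∧ c.R22gen ℓ ∧ q.Valid c.δ₀ ∧ SignsL c α₂ q.B₃ ∧
      ∀ e : ℝ, 0 < e → e ≤ c.ε₁ → ∃ γ₀ : ℝ, 0 < γ₀ ∧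
        ∃ R : ChainTFac190H 4 M μ ν (Sf e) γ₀ (constsAt c e) ℓ α₂ q, CPt R

/-- `ObjectsFamilyCont` ⟹ `RemainderResidueFamily.ObjectsFamily` (forget the clause). [folklore] -/
theorem objectsFamily_of_objectsFamilyCont {βf : ℝ → HBeta} {Sf : (e : ℝ) → B12Beta.OneLoopSplit (βf e)}
    (h : ObjectsFamilyCont βf Sf) : ObjectsFamily βf Sf := by
  obtain ⟨M, hM, μ, ν, c, ℓ, α₂, q, hε, hC, h22, hq, hs, hall⟩ := h
  refine ⟨M, hM, μ, ν, c, ℓ, α₂, q, hε, hC, h22, hq, hs, fun e he hle => ?_⟩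
  obtain ⟨γ₀, hγ₀, R, -⟩ := hall e he hle
  exact ⟨γ₀, hγ₀, ⟨R⟩⟩

/-- **A member with a suitable activity parameter satisfies `AtSlopeCont`** — hence (D4)'s constant form `RemainderConst` AND B4
`BetaContH` on its box (§2): if the family is inhabited and the member `e ≤ c₁` has `e·K ≤ s`, then `AtSlopeCont (Sf e) γ₀ s` on
some box `γ₀ > 0` (`K := K_rem,L` at `c`, `c₁ := c.ε₁`; N1–N3 discharged generically in `e` as in
`RemainderResidueFamily.atSlope_member_of_objectsFamily`). [cite: Balaban1988RG2Cluster, p.21 (after (2.39)); Balaban1987RG1, (1.22) p.264] -/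
theorem atSlopeCont_member_of_objectsFamilyCont {βf : ℝ → HBeta} {Sf : (e : ℝ) → B12Beta.OneLoopSplit (βf e)}
    (h : ObjectsFamilyCont βf Sf) : ∃ K c₁ : ℝ, 0 < c₁ ∧ ∀ e : ℝ, 0 < e → e ≤ c₁ → ∀ s : ℝ, e * K ≤ s →
      ∃ γ₀ : ℝ, 0 < γ₀ ∧ AtSlopeCont (Sf e) γ₀ s := by
  obtain ⟨M, hM, μ, ν, c, ℓ, α₂, q, hε, hC, h22, hq, hs, hall⟩ := h
  have hC3 : 0 ≤ c.C3act := C3act_nonneg_of_signsL' hs hε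
  refine ⟨remCoeffL 4 M c α₂ q.B₃, c.ε₁, hε, fun e he hle s hsK => ?_⟩
  obtain ⟨γ₀, hγ₀, R, hcpt⟩ := hall e he hle
  refine ⟨γ₀, hγ₀, atSlopeCont_of_chainTFac190H R (condsL_constsAt hC hC3 hle) h22 hq (signsL_constsAt' hs hC3 he.le)
    ?_ hcpt⟩
  show e * remCoeffL 4 M (constsAt c e) α₂ q.B₃ ≤ s
  rw [remCoeffL_constsAt]
  exact hsK

/-- **Non-vacuity**: `ObjectsFamilyCont` is inhabited by the CONSTANT family at the trivial split (the zero chain at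
`constsAt (c₀ 4) e` on the box `]0,1]` satisfies (C-pt) by `cpt_ofAnalytic_zeroChain190`); the count for Bałaban's family stays
0∕1. [folklore] -/
theorem objectsFamilyCont_const_splitZero (M : ℕ) [NeZero M] :
    ObjectsFamilyCont (fun _ => fun _ _ => (1 : ℝ)) (fun _ => splitZero) := by
  have hC3 : (c₀ 4).C3act = 162 := Beta.RemainderWitness.c₀_C3act 4
  have hε₀ : 0 < (c₀ 4).ε₁ := by
    have h := c₀_activity_pos 4
    rw [hC3] at h
    linarith
  refine ⟨M, inferInstance, 0, 1, c₀ 4, 2, 1, q₀, hε₀, c₀_condsL 4, c₀_R22gen 4, q₀_valid_c₀ 4,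
    (q₀_valid_c₀ 4).signsL (c₀_activity_pos 4).le one_pos D4Residue.c₀_four_δ₀_pos, fun e he _ => ?_⟩
  have hA : 0 ≤ (constsAt (c₀ 4) e).C3act * (constsAt (c₀ 4) e).ε₁ := by
    show 0 ≤ (c₀ 4).C3act * e
    rw [hC3]; positivity
  exact ⟨1, one_pos, ChainTFac190H.ofAnalytic (zeroChain190 4 M 0 1 1 (constsAt (c₀ 4) e) 2 1 hA),
    cpt_ofAnalytic_zeroChain190 4 M 0 1 1 (constsAt (c₀ 4) e) 2 1 hA⟩

end Family

end Summit.QuantumFields.BalabanUV.Gaps.BetaContFromD4Chain
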